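import Summits.FinalStateConjecture.FinalStateConjecture.Theorems.ClusterCompletenessOmegaLimitMultiKerrTranslateLipschitz
import Summits.FinalStateConjecture.FinalStateConjecture.Theorems.ClusterCompletenessOmegaLimitMultiKerrTranslateCompactness
import Literature.Geometry.Lorentzian.SpacetimeChartDeviationTransfer
import HarnessLib

/-!
# Route ClusterCompleteness · crux `OmegaLimitMultiKerr` — the `Cᵏ_loc` ω-limit set of a tame
# field is connected (no splitting into two families at positive `Cᵏ(K)`-distance, both met)

Structure lemma for the crux stmt-FinalStateConjecture-14664 (`ClusterCompleteness.OmegaLimitMultiKerr`,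
rank 9), line `Sketch`, registered stub `omegaLimits_not_separated` (closed form).

The line reads the recurrence clause of the generic ω-limit dichotomy of the Final State Conjecture
as "the reference multi-Kerr configuration is a `Cᵏ_loc` ω-LIMIT POINT of the late-time translates
`x ↦ h (x + t • e)` of a chart field `h`" (`C^{k+1}` on an open domain `O ⊆ E` invariant under
translation by the Killing direction `e`), convergence being `Cᵏ_loc`:
`supCkENorm K k (h (· + Tₙ • e) − g) → 0` on every compact `K ⊆ O` along times `Tₙ → +∞`. Earlier
generations landed the existence of ω-limits under TAMENESS (all-late-time `C^{k+1}` bounds on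
compacts; `exists_strictMono_tendsto_supCkENorm_translate_sub`, `…TranslateCompactness`), and the
Lipschitz dependence of the translates on time in `Cᵏ(K)`
(`supCkENorm_translate_sub_translate_le`, `…TranslateLipschitz`). This file proves the last clause
of Hale 1980, Ch. I, §8, Thm. 8.1 — the ω-limit set of a precompact positive semi-orbit is
CONNECTED — for the translation flow in the `Cᵏ_loc` topology, in the metric-free form consumed by
the dictionary ("no wandering between separated families of identified dark limits"):

* `omegaLimits_not_separated` (registered stub) — it is impossible that two families `A`, `B` of
  `Cᵏ` fields on `O`, at `Cᵏ(K)`-distance `≥ δ > 0` from each other on one compact `K ⊆ O`, are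
  BOTH met by ω-limits of the translates of a tame `h` while every ω-limit lies (on `O`) in `A` or
  in `B`.

Proof (Hale's argument, discretised): let `f_A ∈ A` be an ω-limit along `Tₙ` and `f_B ∈ B` one
along `Sₘ`, and put `ε = δ / 4`. By tameness on `K` and `supCkENorm_translate_sub_translate_le`
there is a step `σ > 0` with `‖h (· + t • e) − h (· + t' • e)‖_{Cᵏ(K)} ≤ ε` for late `t, t'` with
`|t − t'| ≤ σ`. For every `n` pick a late `Tₚ ≥ n` with `‖h_{Tₚ} − f_A‖_{Cᵏ(K)} < ε` and a later
`Sₘ ≥ Tₚ` with `‖h_{Sₘ} − f_B‖_{Cᵏ(K)} < ε`, and walk along the grid `Tₚ + j σ`: at `j = 0` the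
translate is `ε`-close to a member of `A`; at the grid point next to `Sₘ` it is `ε`-far from all
of `A` (triangle inequality against the separation `δ = 4ε`). At the first crossing `j ↦ j + 1`
the translate `h_{τₙ}`, `τₙ = Tₚ + (j + 1) σ ≥ n`, is `ε`-far from every member of `A` yet
`2ε`-close to one of them. The `Cᵏ` Arzelà–Ascoli theorem for translates along `τₙ → +∞` produces
an ω-limit `g`; if `g` agrees on `O` with a member of `A` the first property is violated
(`supCkENorm_congr`: the sup norm over `K` only sees germs at points of `K`), and if it agrees with
a member of `B` the second one contradicts the separation. Everything is proved; Mathlib + the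
landed `…TranslateLipschitz` / `…TranslateCompactness` / `SpacetimeChartDeviationTransfer` files
only; no definitions.

## References
* J. K. Hale, *Ordinary Differential Equations*, 2nd ed., Krieger 1980, Ch. I §8, Thm. 8.1
  (the ω-limit set of a bounded positive semi-orbit is nonempty, compact, invariant and
  connected). [Hale1980]
* P. Petersen, *Riemannian Geometry*, 2nd ed., GTM 171, Springer 2006, Ch. 10, §3.1
  (`Cᵏ` Arzelà–Ascoli). [Petersen2006]
-/

-- every `Summit.FinalStateConjecture.FinalStateConjecture.…` name repeats the summit = sub-problem segment (D-0017 layout)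
set_option linter.dupNamespace false

noncomputable section

open Set Filter Topology Function
open scoped ContDiff Topology ENNReal

namespace Summit.FinalStateConjecture.FinalStateConjecture.Theorems.ClusterCompleteness

open Literature.Geometry.Lorentzian

/-- Swapping the two terms of a difference does not change its `Cᵏ` sup norm
(`Dᵐ (-f) = -Dᵐ f` unconditionally for Mathlib's `iteratedFDeriv`). [folklore] -/
private theorem supCkENorm_sub_swap {F G : Type*} [NormedAddCommGroup F] [NormedSpace ℝ F]
    [NormedAddCommGroup G] [NormedSpace ℝ G] (S : Set F) (k : ℕ) (f g : F → G) :
    supCkENorm S k (fun x ↦ f x - g x) = supCkENorm S k (fun x ↦ g x - f x) := by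
  have hfg : (fun x ↦ f x - g x) = -fun x ↦ g x - f x := by
    funext x
    simp only [Pi.neg_apply, neg_sub]
  simp only [supCkENorm, hfg, iteratedFDeriv_neg_apply, enorm_neg]

/-- **Triangle inequality through an intermediate field** for the `Cᵏ` sup norm of differences of
functions which are `Cᵏ` at every point of the set: `‖f − g‖ ≤ ‖f − u‖ + ‖u − g‖` in `Cᵏ(S)`.
[folklore] -/
private theorem supCkENorm_sub_le_of_mid {F G : Type*} [NormedAddCommGroup F] [NormedSpace ℝ F]
    [NormedAddCommGroup G] [NormedSpace ℝ G] {S : Set F} {k : ℕ} {f g : F → G} (u : F → G)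
    (hf : ∀ x ∈ S, ContDiffAt ℝ k f x) (hu : ∀ x ∈ S, ContDiffAt ℝ k u x)
    (hg : ∀ x ∈ S, ContDiffAt ℝ k g x) :
    supCkENorm S k (fun x ↦ f x - g x) ≤
      supCkENorm S k (fun x ↦ f x - u x) + supCkENorm S k (fun x ↦ u x - g x) := by
  have heq : (fun x ↦ f x - g x) = (fun x ↦ f x - u x) + fun x ↦ u x - g x := by
    funext x
    simp only [Pi.add_apply, sub_add_sub_cancel]
  rw [heq]
  exact supCkENorm_add_le (fun x hx ↦ (hf x hx).sub (hu x hx)) fun x hx ↦ (hu x hx).sub (hg x hx)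

/-- **The `Cᵏ_loc` ω-limit set of a tame field is connected** (registered structure stub of line
`Sketch`, crux stmt-FinalStateConjecture-14664; closed form): the connectedness clause of Hale 1980,
Ch. I, §8, Thm. 8.1, for the translation flow `h ↦ h (· + t • e)` in the `Cᵏ_loc` topology, in
metric-free form. Let `O ⊆ E` be open and invariant under `x ↦ x + s • e` (`s ∈ ℝ`), `h : E → W` of
class `C^{k+1}` on `O` and TAME along `e` (on every compact `K ⊆ O` the derivatives of order
`≤ k + 1` of `h` at the translated points `z + t • e`, `z ∈ K`, are bounded uniformly for all late
times `t ≥ a`). Let `A`, `B` be two families of `Cᵏ` fields on `O` which are `δ`-SEPARATED in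
`Cᵏ(K)` on one compact `K ⊆ O` (`‖f − f'‖_{Cᵏ(K)} ≥ δ > 0` for `f ∈ A`, `f' ∈ B`), and suppose every
`Cᵏ_loc` ω-limit of the translates of `h` (every `Cᵏ` field `g` on `O` with
`supCkENorm K' k (h (· + Tₙ • e) − g) → 0` on all compacts `K' ⊆ O` along some `Tₙ → +∞`) agrees on
`O` with a member of `A` or with a member of `B`. Then `A` and `B` cannot BOTH contain an ω-limit of
the translates. Proof: a discrete intermediate-value walk between a time where the translate is
`Cᵏ(K)`-close to `A` and a later one where it is close to `B` (the translates being Lipschitz in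
time in `Cᵏ(K)` by tameness, `supCkENorm_translate_sub_translate_le`) yields late times at which the
translate is `δ/4`-far from all of `A` but `δ/2`-close to some member of `A`; an ω-limit along these
times (`Cᵏ` Arzelà–Ascoli, `exists_strictMono_tendsto_supCkENorm_translate_sub`) can lie neither in
`A` nor in `B`. [cite: Hale1980, Ch. I §8 Thm. 8.1] -/
theorem omegaLimits_not_separated :
    ∀ {E : Type*} [NormedAddCommGroup E] [NormedSpace ℝ E] [FiniteDimensional ℝ E]
      {W : Type*} [NormedAddCommGroup W] [NormedSpace ℝ W] [FiniteDimensional ℝ W]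
      {O : Set E} {e : E}, IsOpen O → (∀ x ∈ O, ∀ s : ℝ, x + s • e ∈ O) →
      ∀ {k : ℕ} {h : E → W}, ContDiffOn ℝ (k + 1) h O →
      (∀ K ⊆ O, IsCompact K → ∃ Λ a : ℝ, ∀ t : ℝ, a ≤ t → ∀ i, i ≤ k + 1 → ∀ z ∈ K,
        ‖iteratedFDeriv ℝ i h (z + t • e)‖ ≤ Λ) →
      ∀ (A B : Set (E → W)) (K : Set E), K ⊆ O → IsCompact K → ∀ {δ : ℝ}, 0 < δ →
      (∀ f ∈ A, ContDiffOn ℝ k f O) → (∀ f ∈ B, ContDiffOn ℝ k f O) →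
      (∀ f ∈ A, ∀ f' ∈ B, ENNReal.ofReal δ ≤ supCkENorm K k (fun x ↦ f x - f' x)) →
      (∀ (g : E → W) (T : ℕ → ℝ), ContDiffOn ℝ k g O → Tendsto T atTop atTop →
        (∀ K' ⊆ O, IsCompact K' →
          Tendsto (fun n ↦ supCkENorm K' k (fun x ↦ h (x + T n • e) - g x)) atTop (𝓝 0)) →
        (∃ f ∈ A, ∀ x ∈ O, g x = f x) ∨ (∃ f ∈ B, ∀ x ∈ O, g x = f x)) →
      (∃ f ∈ A, ∃ T : ℕ → ℝ, Tendsto T atTop atTop ∧ ∀ K' ⊆ O, IsCompact K' →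
          Tendsto (fun n ↦ supCkENorm K' k (fun x ↦ h (x + T n • e) - f x)) atTop (𝓝 0)) →
      (∃ f ∈ B, ∃ T : ℕ → ℝ, Tendsto T atTop atTop ∧ ∀ K' ⊆ O, IsCompact K' →
          Tendsto (fun n ↦ supCkENorm K' k (fun x ↦ h (x + T n • e) - f x)) atTop (𝓝 0)) →
      False := by
  intro E _ _ _ W _ _ _ O e hO hOe k h hh htame A B K hKO hK δ hδ hA hB hsep hcover hmetA hmetB
  obtain ⟨fA, hfA, T, hT, hconvA⟩ := hmetA
  obtain ⟨fB, hfB, S, hS, hconvB⟩ := hmetB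
  -- (0) regularity at the points of `K ⊆ O`: translates of `h`, members of `A` and of `B` are `Cᵏ`
  have hk1 : (k : WithTop ℕ∞) ≤ k + 1 := by exact_mod_cast Nat.le_succ k
  have htr : ∀ s : ℝ, ∀ x ∈ K, ContDiffAt ℝ k (fun y ↦ h (y + s • e)) x := by
    intro s x hx
    have h1 : ContDiffOn ℝ (k + 1) (fun y ↦ h (y + s • e)) O :=
      hh.comp (contDiff_id.add contDiff_const).contDiffOn fun y hy ↦ hOe y hy s
    exact (h1.of_le hk1).contDiffAt (hO.mem_nhds (hKO hx))
  have hAK : ∀ f ∈ A, ∀ x ∈ K, ContDiffAt ℝ k f x := fun f hf x hx ↦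
    (hA f hf).contDiffAt (hO.mem_nhds (hKO hx))
  have hBK : ∀ f ∈ B, ∀ x ∈ K, ContDiffAt ℝ k f x := fun f hf x hx ↦
    (hB f hf).contDiffAt (hO.mem_nhds (hKO hx))
  -- (1) separation, read at a translate: `δ ≤ ‖h_t − f‖_{Cᵏ(K)} + ‖h_t − f'‖_{Cᵏ(K)}`
  have hkey : ∀ f ∈ A, ∀ f' ∈ B, ∀ t : ℝ, ENNReal.ofReal δ ≤
      supCkENorm K k (fun x ↦ h (x + t • e) - f x) +
        supCkENorm K k (fun x ↦ h (x + t • e) - f' x) := by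
    intro f hf f' hf' t
    calc ENNReal.ofReal δ ≤ supCkENorm K k (fun x ↦ f x - f' x) := hsep f hf f' hf'
      _ ≤ supCkENorm K k (fun x ↦ f x - h (x + t • e)) +
            supCkENorm K k (fun x ↦ h (x + t • e) - f' x) :=
          supCkENorm_sub_le_of_mid _ (hAK f hf) (htr t) (hBK f' hf')
      _ ≤ _ := add_le_add (supCkENorm_sub_swap K k _ _).le le_rfl
  -- (2) the scales: `ε = δ / 4`, and a time step `σ` on which late translates move by `≤ ε`
  obtain ⟨ε, hε0, hε4⟩ : ∃ ε : ℝ, 0 < ε ∧ 4 * ε = δ := ⟨δ / 4, by positivity, by ring⟩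
  have hεpos : (0 : ℝ≥0∞) < ENNReal.ofReal ε := ENNReal.ofReal_pos.2 hε0
  obtain ⟨Λ, a, hΛ⟩ := htame K hKO hK
  obtain ⟨σ, hσ0, hσε⟩ : ∃ σ : ℝ, 0 < σ ∧ |Λ| * ‖e‖ * σ ≤ ε := by
    refine ⟨ε / (|Λ| * ‖e‖ + 1), by positivity, ?_⟩
    rw [mul_div_assoc', div_le_iff₀ (by positivity)]
    nlinarith [mul_nonneg (abs_nonneg Λ) (norm_nonneg e)]
  -- (3) translates are Lipschitz in time in `Cᵏ(K)` for late times (tameness on `K`)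
  have hlip : ∀ t t' : ℝ, a ≤ t → a ≤ t' → |t - t'| ≤ σ →
      supCkENorm K k (fun x ↦ h (x + t • e) - h (x + t' • e)) ≤ ENNReal.ofReal ε := by
    intro t t' ht ht' htt'
    have hseg : ∀ s ∈ uIcc t t', a ≤ s := fun s hs ↦ (le_min ht ht').trans hs.1
    refine (supCkENorm_translate_sub_translate_le hO hh (Λ := |Λ|)
      (fun x hx s _ ↦ hOe x (hKO hx) s)
      (fun i _ hi x hx s hs ↦ (hΛ s (hseg s hs) i hi x hx).trans (le_abs_self Λ))).trans ?_
    refine ENNReal.ofReal_le_ofReal ?_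
    calc |Λ| * ‖e‖ * |t - t'| ≤ |Λ| * ‖e‖ * σ := by gcongr
      _ ≤ ε := hσε
  -- (4) discrete intermediate value: arbitrarily late times at which the translate is `ε`-far
  --     from every member of `A` in `Cᵏ(K)`, yet `2ε`-close to some member of `A`
  have hwalk : ∀ n : ℕ, ∃ t : ℝ, (n : ℝ) ≤ t ∧
      (∀ f ∈ A, ENNReal.ofReal ε ≤ supCkENorm K k (fun x ↦ h (x + t • e) - f x)) ∧
      ∃ f ∈ A, supCkENorm K k (fun x ↦ h (x + t • e) - f x) ≤ ENNReal.ofReal (2 * ε) := by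
    intro n
    -- a late time `T p ≥ max n a` at which the translate is `ε`-close to `fA ∈ A` …
    obtain ⟨p, hpn, hpA⟩ := ((hT.eventually_ge_atTop (max (n : ℝ) a)).and
      ((hconvA K hKO hK).eventually (gt_mem_nhds hεpos))).exists
    obtain ⟨hpn, hpa⟩ := max_le_iff.1 hpn
    -- … and a later time `S m ≥ T p` at which it is `ε`-close to `fB ∈ B`
    obtain ⟨m, hmp, hmB⟩ := ((hS.eventually_ge_atTop (T p)).and
      ((hconvB K hKO hK).eventually (gt_mem_nhds hεpos))).exists
    -- the grid `u j = T p + j σ`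
    obtain ⟨u, hu⟩ : ∃ u : ℕ → ℝ, ∀ j, u j = T p + j * σ := ⟨_, fun j ↦ rfl⟩
    have huge : ∀ j, T p ≤ u j := fun j ↦ by
      rw [hu]
      exact le_add_of_nonneg_right (by positivity)
    have hua : ∀ j, a ≤ u j := fun j ↦ hpa.trans (huge j)
    have hustep : ∀ j, |u (j + 1) - u j| ≤ σ := by
      intro j
      rw [hu, hu, Nat.cast_succ, show T p + (j + 1 : ℝ) * σ - (T p + j * σ) = σ by ring,
        abs_of_pos hσ0]
    -- the grid point next below `S m`
    obtain ⟨J, hJ⟩ : ∃ J : ℕ, |u J - S m| ≤ σ := by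
      refine ⟨⌊(S m - T p) / σ⌋₊, ?_⟩
      have hq : 0 ≤ (S m - T p) / σ := div_nonneg (sub_nonneg.2 hmp) hσ0.le
      have h1 : (⌊(S m - T p) / σ⌋₊ : ℝ) * σ ≤ S m - T p := (le_div_iff₀ hσ0).1 (Nat.floor_le hq)
      have h2 : S m - T p < ((⌊(S m - T p) / σ⌋₊ : ℝ) + 1) * σ :=
        (div_lt_iff₀ hσ0).1 (Nat.lt_floor_add_one _)
      rw [hu, abs_le]
      constructor <;> linarith
    -- "the translate at `u j` is `ε`-far from every member of `A`" fails at `j = 0` …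
    have hQ0 : ¬ ∀ f ∈ A, ENNReal.ofReal ε ≤ supCkENorm K k (fun x ↦ h (x + u 0 • e) - f x) := by
      intro hQ
      have h0 : u 0 = T p := by rw [hu, Nat.cast_zero, zero_mul, add_zero]
      have h1 := hQ fA hfA
      rw [h0] at h1
      exact absurd hpA (not_lt.2 h1)
    -- … and holds at `j = J` (triangle inequality against the separation `δ = 4ε`)
    have hQJ : ∀ f ∈ A, ENNReal.ofReal ε ≤ supCkENorm K k (fun x ↦ h (x + u J • e) - f x) := by
      intro f hf
      by_contra! hlt
      have h3 : supCkENorm K k (fun x ↦ h (x + u J • e) - h (x + S m • e)) ≤ ENNReal.ofReal ε :=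
        hlip (u J) (S m) (hua J) (hpa.trans hmp) hJ
      have h4 : supCkENorm K k (fun x ↦ h (x + u J • e) - fB x) <
          ENNReal.ofReal ε + ENNReal.ofReal ε :=
        (supCkENorm_sub_le_of_mid _ (htr (u J)) (htr (S m)) (hBK fB hfB)).trans_lt
          (ENNReal.add_lt_add_of_le_of_lt (ne_top_of_le_ne_top ENNReal.ofReal_ne_top h3) h3 hmB)
      have h5 : ENNReal.ofReal δ < ENNReal.ofReal ε + (ENNReal.ofReal ε + ENNReal.ofReal ε) :=
        (hkey f hf fB hfB (u J)).trans_lt (ENNReal.add_lt_add hlt h4)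
      rw [← ENNReal.ofReal_add hε0.le hε0.le, ← ENNReal.ofReal_add hε0.le (by positivity),
        ENNReal.ofReal_lt_ofReal_iff (by positivity)] at h5
      linarith
    -- the first crossing `j ↦ j + 1`
    obtain ⟨j, hj, hj1⟩ := Nat.exists_not_and_succ_of_not_zero_of_exists
      (p := fun j ↦ ∀ f ∈ A, ENNReal.ofReal ε ≤ supCkENorm K k (fun x ↦ h (x + u j • e) - f x))
      hQ0 ⟨J, hQJ⟩
    push Not at hj
    obtain ⟨f, hf, hfj⟩ := hj
    refine ⟨u (j + 1), hpn.trans (huge (j + 1)), hj1, f, hf, ?_⟩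
    calc supCkENorm K k (fun x ↦ h (x + u (j + 1) • e) - f x)
        ≤ supCkENorm K k (fun x ↦ h (x + u (j + 1) • e) - h (x + u j • e)) +
            supCkENorm K k (fun x ↦ h (x + u j • e) - f x) :=
          supCkENorm_sub_le_of_mid _ (htr _) (htr _) (hAK f hf)
      _ ≤ ENNReal.ofReal ε + ENNReal.ofReal ε :=
          add_le_add (hlip _ _ (hua _) (hua _) (hustep j)) hfj.le
      _ = ENNReal.ofReal (2 * ε) := by rw [← ENNReal.ofReal_add hε0.le hε0.le, two_mul]
  -- (5) an ω-limit along these times: `Cᵏ` Arzelà–Ascoli for the translates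
  choose τ hτn hτfar hτnear using hwalk
  have hτ0 : ∀ n, 0 ≤ τ n := fun n ↦ (Nat.cast_nonneg n).trans (hτn n)
  have hτtop : Tendsto τ atTop atTop := tendsto_atTop_mono hτn tendsto_natCast_atTop_atTop
  have hOe' : ∀ x ∈ O, ∀ s : ℝ, 0 ≤ s → x + s • e ∈ O := fun x hx s _ ↦ hOe x hx s
  have hbnd : ∀ K' ⊆ O, IsCompact K' → ∃ Λ' : ℝ, ∀ᶠ n in atTop, ∀ i, i ≤ k + 1 → ∀ z ∈ K',
      ‖iteratedFDeriv ℝ i h (z + τ n • e)‖ ≤ Λ' := by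
    intro K' hK'O hK'
    obtain ⟨Λ', a', hΛ'⟩ := htame K' hK'O hK'
    refine ⟨Λ', ?_⟩
    filter_upwards [hτtop.eventually_ge_atTop a'] with n hn
    exact hΛ' (τ n) hn
  obtain ⟨g, φ, hφ, hgk, hlim⟩ :=
    exists_strictMono_tendsto_supCkENorm_translate_sub hO hOe' hh hτ0 hbnd
  -- the sup norm over `K ⊆ O` only sees the germs at points of `K`
  have hcongr : ∀ f : E → W, (∀ x ∈ O, g x = f x) → ∀ t : ℝ,
      supCkENorm K k (fun x ↦ h (x + t • e) - f x) =
        supCkENorm K k (fun x ↦ h (x + t • e) - g x) := by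
    intro f hgf t
    refine supCkENorm_congr fun x hx ↦ ?_
    filter_upwards [hO.mem_nhds (hKO hx)] with y hy
    rw [hgf y hy]
  have hlimK := hlim K hKO hK
  -- (6) the ω-limit `g` lies in `A` or in `B`; both are absurd
  rcases hcover g (fun n ↦ τ (φ n)) hgk (hτtop.comp hφ.tendsto_atTop) hlim with
    ⟨f, hf, hgf⟩ | ⟨f', hf', hgf'⟩
  · -- `g ∈ A`: but the translates at the times `τ` stay `ε`-far from `A` in `Cᵏ(K)`
    obtain ⟨n, hn⟩ := (hlimK.eventually (gt_mem_nhds hεpos)).exists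
    have hfar := hτfar (φ n) f hf
    rw [hcongr f hgf] at hfar
    exact absurd hn (not_lt.2 hfar)
  · -- `g ∈ B`: but the translates at the times `τ` are `2ε`-close to `A`, and `δ = 4ε`
    have h2εpos : (0 : ℝ≥0∞) < ENNReal.ofReal (2 * ε) := ENNReal.ofReal_pos.2 (by positivity)
    obtain ⟨n, hn⟩ := (hlimK.eventually (gt_mem_nhds h2εpos)).exists
    obtain ⟨f, hf, hfn⟩ := hτnear (φ n)
    have h1 := hkey f hf f' hf' (τ (φ n))
    rw [hcongr f' hgf'] at h1
    have h2 : ENNReal.ofReal δ < ENNReal.ofReal (2 * ε) + ENNReal.ofReal (2 * ε) :=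
      h1.trans_lt
        (ENNReal.add_lt_add_of_le_of_lt (ne_top_of_le_ne_top ENNReal.ofReal_ne_top hfn) hfn hn)
    rw [← ENNReal.ofReal_add (by positivity) (by positivity),
      ENNReal.ofReal_lt_ofReal_iff (by positivity)] at h2
    linarith

end Summit.FinalStateConjecture.FinalStateConjecture.Theorems.ClusterCompleteness

end
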